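import Mathlib.MeasureTheory.Integral.Bochner.ContinuousLinearMap
import Mathlib.Analysis.SpecialFunctions.Trigonometric.Chebyshev.RootsExtrema
import Summits.QuantumFields.YangMills.Theorems.BalabanUVNodesN19OctalLacunaryDissociation
import Summits.QuantumFields.YangMills.Theorems.BalabanUVNodesN19ChebyshevArcFunctional

/-!
# N19 (NE7, s3 ALTERNATIVE CURRENCY) — The Riesz-product laws: independent lacunary toggles

Module 101 of the `dag-n19-e` lineage (CURRENCY-MAP v4 open item (y)).  For a finite set `A` of LEVELS and a scale
`|c| ≤ 1`, the RIESZ-PRODUCT LAW `λ_A` is the law of `c·cos φ` under the density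
`ρ_A(φ)∕π = (1∕π)∏_{e∈A}(1 + cos(8^{e+1}φ))` on `[0,π]` — a probability law on `[−|c|,|c|] ⊆ [−1,1]` (module 100:
`∫_0^π ρ_A = π`).  ★ `exists_rieszLaws` packages the family with its integral formula
`∫f dλ_A = (1∕π)∫_0^π f(c·cos φ)ρ_A(φ)dφ`; everything else is proved FROM THAT FORMULA:

* `integral_toggle_sub`: TOGGLING a level `e ∉ A` changes `∫f dλ` by `(1∕π)∫_0^π f(c cos φ)cos(8^{e+1}φ)ρ_A(φ)dφ`;
* ★ `moment_toggle_eq`: the moments `j ≤ 6·8^e` DO NOT MOVE (module 100 (c′)), whatever the other active levels;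
  `abs_moment_toggle_sub_le`: every moment moves by `≤ |c|^j` (the uniform-moment currency at scale `½`);
* ★ `abs_mgf_toggle_sub_le`: on the window `|t| ≤ l₀` with `2l₀ ≤ 6·8^e + 2` the mgf moves by
  `≤ 2l₀^{6·8^e+1}∕(6·8^e+1)!` (module 71's Taylor remainder `abs_exp_sub_taylor_le`; the Taylor polynomial is
  invisible by the frozen moments) and ★ `abs_cgf_toggle_sub_le`: the cgf by `e^{l₀}`× that (module 64);
* ★ `integral_rieszTest_toggle_sub` (scale `1`): the polynomial test `(1−x²)T_n(x)∕(4n)`, `n = 8^{e+1}` —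
  `1`-Lipschitz and `1∕(4n)`-bounded on `[−1,1]` (`rieszTest_lipschitz_bound`, Mathlib's
  `one_sub_X_sq_mul_derivative_T_eq_poly_in_T` + `abs_eval_T_real_le_one`) — is paid EXACTLY `1∕(16n)` by the toggle
  (module 100 (d′): `(1−cos²φ)T_n(cos φ) = sin²φ·cos(nφ)`).

So every level can be switched on or off at any time, at ITS OWN window price and with ITS OWN payment, whatever
the other levels do — the device that frees module 75's threshold from the monotonicity of the remainder (module 102).

HONEST FRAMING: [folklore] (Riesz products, Zygmund *Trigonometric Series* V.7, in the arcsine road's coordinates of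
module 95) over Mathlib and modules 64 ∕ 71 ∕ 100 BY NAME; TOY laws; no scheme object, no consumer in the DAG today;
nothing of Bałaban's is instantiated; NE7 is NOT PRINTED and NOT proved here; N19 is NOT discharged; count-neutral.
One finite 𝕋⁴ programme at fixed ε; nothing continuum ∕ OS ∕ mass-gap ∕ Clay.  0 `def` ∕ 0 `sorry`.
-/

noncomputable section

open Real Finset MeasureTheory ProbabilityTheory Polynomial Polynomial.Chebyshev

namespace Summit.QuantumFields.YangMills.Theorems.BalabanUVNodesN19RieszProductLaws

open BalabanUVNodesN19OctalLacunaryDissociation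
open BalabanUVNodesN19ChebyshevArcFunctional (abs_exp_sub_taylor_le)
open BalabanUVNodesN19LawIncrementsTarget (abs_log_sub_log_le_of_exp_neg_le exp_neg_le_mgf_id_of_Icc_symm)

/-! ## §1 The laws [folklore] -/

/-- ★ **THE RIESZ-PRODUCT LAWS.**  For every scale `|c| ≤ 1` there is a family `λ_A` (`A` a finite set of levels) of
probability laws on `[−1,1]`, carried by `[−|c|,|c|]`, integrating every continuous `f` to
`(1∕π)∫_0^π f(c·cos φ)·∏_{e∈A}(1 + cos(8^{e+1}φ))dφ` — the law of `c·cos φ` under the Riesz density. [folklore] -/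
theorem exists_rieszLaws {c : ℝ} (hc : |c| ≤ 1) :
    ∃ Λ : Finset ℕ → Measure ℝ, (∀ A, IsProbabilityMeasure (Λ A)) ∧ (∀ A, Λ A (Set.Icc (-1 : ℝ) 1)ᶜ = 0) ∧
      (∀ A, Λ A (Set.Icc (-|c|) |c|)ᶜ = 0) ∧
      ∀ (A : Finset ℕ) (f : ℝ → ℝ), Continuous f →
        ∫ x, f x ∂(Λ A) = (1 / π) * ∫ φ in (0 : ℝ)..π, f (c * Real.cos φ) *
          ∏ e ∈ A, (1 + Real.cos ((8 : ℝ) ^ (e + 1) * φ)) := by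
  -- the density on `[0,π]`, as an `ℝ≥0`-valued function
  set ρ : Finset ℕ → ℝ → NNReal := fun A φ =>
    Real.toNNReal ((∏ e ∈ A, (1 + Real.cos ((8 : ℝ) ^ (e + 1) * φ))) / π) with hρ
  have hρm : ∀ A, Measurable (ρ A) := fun A =>
    (((continuous_rieszDensity A).div_const _).measurable).real_toNNReal
  have hρnn : ∀ A φ, 0 ≤ (∏ e ∈ A, (1 + Real.cos ((8 : ℝ) ^ (e + 1) * φ))) / π := fun A φ =>
    div_nonneg (rieszDensity_nonneg A φ) Real.pi_pos.le
  set μ : Finset ℕ → Measure ℝ := fun A =>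
    ((volume : Measure ℝ).restrict (Set.Ioc 0 π)).withDensity fun φ => (ρ A φ : ENNReal) with hμ
  have hmeas : Measurable fun φ : ℝ => c * Real.cos φ := Real.measurable_cos.const_mul _
  set Λ : Finset ℕ → Measure ℝ := fun A => (μ A).map fun φ => c * Real.cos φ with hΛ
  -- integrals against `μ A` are interval integrals with the density
  have hint : ∀ (A : Finset ℕ) (F : ℝ → ℝ), Continuous F →
      ∫ φ, F φ ∂(μ A) = ∫ φ in (0 : ℝ)..π, (∏ e ∈ A, (1 + Real.cos ((8 : ℝ) ^ (e + 1) * φ))) / π * F φ := by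
    intro A F hF
    simp only [hμ]
    rw [integral_withDensity_eq_integral_smul (hρm A), intervalIntegral.integral_of_le Real.pi_pos.le]
    refine setIntegral_congr_fun measurableSet_Ioc fun φ _ => ?_
    simp only [hρ, NNReal.smul_def, smul_eq_mul, Real.coe_toNNReal _ (hρnn A φ)]
  have hcc : ∀ φ : ℝ, c * Real.cos φ ∈ Set.Icc (-|c|) |c| := fun φ => by
    have h1 : |c * Real.cos φ| ≤ |c| := by
      rw [abs_mul]; exact mul_le_of_le_one_right (abs_nonneg _) (Real.abs_cos_le_one _)
    exact ⟨(abs_le.1 h1).1, (abs_le.1 h1).2⟩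
  refine ⟨Λ, fun A => ?_, fun A => ?_, fun A => ?_, fun A f hf => ?_⟩
  · -- probability
    have hμ1 : IsProbabilityMeasure (μ A) := by
      constructor
      simp only [hμ]
      rw [withDensity_apply _ MeasurableSet.univ, Measure.restrict_univ, lintegral_coe_eq_integral _ ?_]
      · have h1 := hint A (fun _ => 1) continuous_const
        rw [hμ] at h1
        simp only [mul_one] at h1
        have h2 : ∫ φ in Set.Ioc 0 π, ((ρ A φ : NNReal) : ℝ) =
            ∫ φ in (0 : ℝ)..π, (∏ e ∈ A, (1 + Real.cos ((8 : ℝ) ^ (e + 1) * φ))) / π := by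
          rw [intervalIntegral.integral_of_le Real.pi_pos.le]
          refine setIntegral_congr_fun measurableSet_Ioc fun φ _ => ?_
          simp only [hρ, Real.coe_toNNReal _ (hρnn A φ)]
        rw [h2, intervalIntegral.integral_div, integral_rieszDensity A, div_self Real.pi_ne_zero, ENNReal.ofReal_one]
      · refine Measure.integrableOn_of_bounded (M := (2 : ℝ) ^ A.card / π) measure_Ioc_lt_top.ne
          (NNReal.continuous_coe.measurable.comp (hρm A)).aestronglyMeasurable
          (Filter.Eventually.of_forall fun φ => ?_)
        simp only [hρ, Real.norm_eq_abs, Real.coe_toNNReal _ (hρnn A φ)]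
        rw [abs_of_nonneg (hρnn A φ)]
        refine div_le_div_of_nonneg_right ?_ Real.pi_pos.le
        rw [← Finset.prod_const]
        exact Finset.prod_le_prod (fun e _ => by linarith [Real.neg_one_le_cos ((8 : ℝ) ^ (e + 1) * φ)])
          fun e _ => by linarith [Real.cos_le_one ((8 : ℝ) ^ (e + 1) * φ)]
    simp only [hΛ]
    exact Measure.isProbabilityMeasure_map hmeas.aemeasurable
  · -- support in `[−1,1]`
    simp only [hΛ]
    rw [Measure.map_apply hmeas (measurableSet_Icc.compl)]
    have : (fun φ : ℝ => c * Real.cos φ) ⁻¹' (Set.Icc (-1 : ℝ) 1)ᶜ = ∅ := by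
      ext φ
      simp only [Set.mem_preimage, Set.mem_compl_iff, Set.mem_Icc, Set.mem_empty_iff_false, iff_false, not_not]
      have h := hcc φ
      exact ⟨by linarith [h.1, neg_le_neg hc], h.2.trans hc⟩
    rw [this, measure_empty]
  · -- support in `[−|c|,|c|]`
    simp only [hΛ]
    rw [Measure.map_apply hmeas (measurableSet_Icc.compl)]
    have : (fun φ : ℝ => c * Real.cos φ) ⁻¹' (Set.Icc (-|c|) |c|)ᶜ = ∅ := by
      ext φ
      simp only [Set.mem_preimage, Set.mem_compl_iff, Set.mem_empty_iff_false, iff_false, not_not]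
      exact hcc φ
    rw [this, measure_empty]
  · -- integral formula
    simp only [hΛ]
    rw [integral_map hmeas.aemeasurable hf.aestronglyMeasurable,
      hint A (fun φ => f (c * Real.cos φ)) (hf.comp (continuous_const.mul Real.continuous_cos)),
      ← intervalIntegral.integral_const_mul]
    refine intervalIntegral.integral_congr fun φ _ => ?_
    ring

/-! ## §2 Toggling one level: the difference formula, frozen moments, the window price [folklore] -/

/-- ★ THE TOGGLE FORMULA: for `e ∉ A` and continuous `f`,
`∫f dλ_{A∪{e}} − ∫f dλ_A = (1∕π)∫_0^π f(c cos φ)·cos(8^{e+1}φ)·ρ_A(φ)dφ`. [folklore] -/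
theorem integral_toggle_sub {Λ : Finset ℕ → Measure ℝ} {c : ℝ}
    (hΛ : ∀ (A : Finset ℕ) (f : ℝ → ℝ), Continuous f →
      ∫ x, f x ∂(Λ A) = (1 / π) * ∫ φ in (0 : ℝ)..π, f (c * Real.cos φ) *
        ∏ e ∈ A, (1 + Real.cos ((8 : ℝ) ^ (e + 1) * φ)))
    {A : Finset ℕ} {e : ℕ} (he : e ∉ A) {f : ℝ → ℝ} (hf : Continuous f) :
    ∫ x, f x ∂(Λ (insert e A)) - ∫ x, f x ∂(Λ A) =
      (1 / π) * ∫ φ in (0 : ℝ)..π, f (c * Real.cos φ) * Real.cos ((8 : ℝ) ^ (e + 1) * φ) *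
        ∏ k ∈ A, (1 + Real.cos ((8 : ℝ) ^ (k + 1) * φ)) := by
  classical
  have hfc : Continuous fun φ : ℝ => f (c * Real.cos φ) := hf.comp (continuous_const.mul Real.continuous_cos)
  have hi : ∀ B : Finset ℕ, IntervalIntegrable (fun φ : ℝ => f (c * Real.cos φ) *
      ∏ e ∈ B, (1 + Real.cos ((8 : ℝ) ^ (e + 1) * φ))) volume 0 π := fun B =>
    (hfc.mul (continuous_rieszDensity B)).intervalIntegrable _ _
  rw [hΛ _ f hf, hΛ _ f hf, ← mul_sub, ← intervalIntegral.integral_sub (hi _) (hi _)]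
  congr 1
  refine intervalIntegral.integral_congr fun φ _ => ?_
  simp only [Finset.prod_insert he]
  ring

/-- ★ **THE MOMENTS `j ≤ 6·8^e` DO NOT MOVE** when level `e ∉ A` is toggled:
`∫x^j dλ_{A∪{e}} = ∫x^j dλ_A` (module 100 (c′)). [folklore] -/
theorem moment_toggle_eq {Λ : Finset ℕ → Measure ℝ} {c : ℝ}
    (hΛ : ∀ (A : Finset ℕ) (f : ℝ → ℝ), Continuous f →
      ∫ x, f x ∂(Λ A) = (1 / π) * ∫ φ in (0 : ℝ)..π, f (c * Real.cos φ) *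
        ∏ e ∈ A, (1 + Real.cos ((8 : ℝ) ^ (e + 1) * φ)))
    {A : Finset ℕ} {e : ℕ} (he : e ∉ A) {j : ℕ} (hj : j ≤ 6 * 8 ^ e) :
    ∫ x, x ^ j ∂(Λ (insert e A)) = ∫ x, x ^ j ∂(Λ A) := by
  refine sub_eq_zero.1 ?_
  rw [integral_toggle_sub hΛ he (continuous_pow j)]
  have e1 : (fun φ : ℝ => (c * Real.cos φ) ^ j * Real.cos ((8 : ℝ) ^ (e + 1) * φ) *
      ∏ k ∈ A, (1 + Real.cos ((8 : ℝ) ^ (k + 1) * φ))) = fun φ => c ^ j * (Real.cos φ ^ j *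
        Real.cos ((8 : ℝ) ^ (e + 1) * φ) * ∏ k ∈ A, (1 + Real.cos ((8 : ℝ) ^ (k + 1) * φ))) := by
    funext φ; rw [mul_pow]; ring
  rw [e1, intervalIntegral.integral_const_mul, integral_cos_pow_mul_cosOct_mul_rieszDensity_eq_zero he hj]
  simp

/-- `|∫_0^π g·ρ_A| ≤ B·π` for a continuous `g` with `|g| ≤ B` (`ρ_A ≥ 0` has mass `π`). [bookkeeping] -/
theorem abs_integral_mul_rieszDensity_le {g : ℝ → ℝ} (hg : Continuous g) {B : ℝ} (hB : ∀ φ, |g φ| ≤ B)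
    (A : Finset ℕ) :
    |∫ φ in (0 : ℝ)..π, g φ * ∏ e ∈ A, (1 + Real.cos ((8 : ℝ) ^ (e + 1) * φ))| ≤ B * π := by
  have hρc := continuous_rieszDensity A
  have hi : IntervalIntegrable (fun φ : ℝ => g φ * ∏ e ∈ A, (1 + Real.cos ((8 : ℝ) ^ (e + 1) * φ)))
      volume 0 π := (hg.mul hρc).intervalIntegrable _ _
  have hiabs : IntervalIntegrable (fun φ : ℝ => |g φ * ∏ e ∈ A, (1 + Real.cos ((8 : ℝ) ^ (e + 1) * φ))|)
      volume 0 π := hi.abs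
  have hiB : IntervalIntegrable (fun φ : ℝ => B * ∏ e ∈ A, (1 + Real.cos ((8 : ℝ) ^ (e + 1) * φ)))
      volume 0 π := (hρc.intervalIntegrable _ _).const_mul _
  calc |∫ φ in (0 : ℝ)..π, g φ * ∏ e ∈ A, (1 + Real.cos ((8 : ℝ) ^ (e + 1) * φ))|
      ≤ ∫ φ in (0 : ℝ)..π, |g φ * ∏ e ∈ A, (1 + Real.cos ((8 : ℝ) ^ (e + 1) * φ))| :=
        intervalIntegral.abs_integral_le_integral_abs Real.pi_pos.le
    _ ≤ ∫ φ in (0 : ℝ)..π, B * ∏ e ∈ A, (1 + Real.cos ((8 : ℝ) ^ (e + 1) * φ)) := by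
        refine intervalIntegral.integral_mono_on Real.pi_pos.le hiabs hiB fun φ _ => ?_
        rw [abs_mul, abs_of_nonneg (rieszDensity_nonneg A φ)]
        exact mul_le_mul_of_nonneg_right (hB φ) (rieszDensity_nonneg A φ)
    _ = B * π := by rw [intervalIntegral.integral_const_mul, integral_rieszDensity]

/-- THE UNIFORM-MOMENT PRICE OF A TOGGLE: every moment moves by at most `|c|^j` (the support is `[−|c|,|c|]`).
[folklore] -/
theorem abs_moment_toggle_sub_le {Λ : Finset ℕ → Measure ℝ} {c : ℝ}
    (hΛ : ∀ (A : Finset ℕ) (f : ℝ → ℝ), Continuous f →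
      ∫ x, f x ∂(Λ A) = (1 / π) * ∫ φ in (0 : ℝ)..π, f (c * Real.cos φ) *
        ∏ e ∈ A, (1 + Real.cos ((8 : ℝ) ^ (e + 1) * φ)))
    {A : Finset ℕ} {e : ℕ} (he : e ∉ A) (j : ℕ) :
    |∫ x, x ^ j ∂(Λ (insert e A)) - ∫ x, x ^ j ∂(Λ A)| ≤ |c| ^ j := by
  rw [integral_toggle_sub hΛ he (continuous_pow j)]
  have e1 : (fun φ : ℝ => (c * Real.cos φ) ^ j * Real.cos ((8 : ℝ) ^ (e + 1) * φ) *
      ∏ k ∈ A, (1 + Real.cos ((8 : ℝ) ^ (k + 1) * φ))) = fun φ => c ^ j * ((Real.cos φ ^ j *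
        Real.cos ((8 : ℝ) ^ (e + 1) * φ)) * ∏ k ∈ A, (1 + Real.cos ((8 : ℝ) ^ (k + 1) * φ))) := by
    funext φ; rw [mul_pow]; ring
  rw [e1, intervalIntegral.integral_const_mul]
  have hgc : Continuous fun φ : ℝ => Real.cos φ ^ j * Real.cos ((8 : ℝ) ^ (e + 1) * φ) :=
    (Real.continuous_cos.pow j).mul (Real.continuous_cos.comp (continuous_const.mul continuous_id))
  have hB1 : ∀ φ : ℝ, |Real.cos φ ^ j * Real.cos ((8 : ℝ) ^ (e + 1) * φ)| ≤ 1 := fun φ => by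
    rw [abs_mul, abs_pow]
    exact mul_le_one₀ (pow_le_one₀ (abs_nonneg _) (Real.abs_cos_le_one _)) (abs_nonneg _) (Real.abs_cos_le_one _)
  have hb : |∫ φ in (0 : ℝ)..π, Real.cos φ ^ j * Real.cos ((8 : ℝ) ^ (e + 1) * φ) *
      ∏ k ∈ A, (1 + Real.cos ((8 : ℝ) ^ (k + 1) * φ))| ≤ 1 * π := abs_integral_mul_rieszDensity_le hgc hB1 A
  rw [abs_mul, abs_mul, abs_div, abs_one, abs_of_pos Real.pi_pos, abs_pow]
  calc 1 / π * (|c| ^ j * |∫ φ in (0 : ℝ)..π, Real.cos φ ^ j * Real.cos ((8 : ℝ) ^ (e + 1) * φ) *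
        ∏ k ∈ A, (1 + Real.cos ((8 : ℝ) ^ (k + 1) * φ))|) ≤ 1 / π * (|c| ^ j * (1 * π)) := by
        gcongr
    _ = |c| ^ j := by field_simp

/-- ★ **THE WINDOW PRICE OF A TOGGLE (mgf).**  For `|c| ≤ 1`, `e ∉ A`, `|t| ≤ l₀` and `2l₀ ≤ 6·8^e + 2`:
`|mgf λ_{A∪{e}}(t) − mgf λ_A(t)| ≤ 2·l₀^{6·8^e+1}∕(6·8^e+1)!` — the Taylor polynomial of `e^{tx}` of degree `6·8^e`
is invisible (frozen moments), the remainder is module 71's `abs_exp_sub_taylor_le`. [folklore] -/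
theorem abs_mgf_toggle_sub_le {Λ : Finset ℕ → Measure ℝ} {c : ℝ} (hc : |c| ≤ 1)
    (hΛ : ∀ (A : Finset ℕ) (f : ℝ → ℝ), Continuous f →
      ∫ x, f x ∂(Λ A) = (1 / π) * ∫ φ in (0 : ℝ)..π, f (c * Real.cos φ) *
        ∏ e ∈ A, (1 + Real.cos ((8 : ℝ) ^ (e + 1) * φ)))
    {A : Finset ℕ} {e : ℕ} (he : e ∉ A) {l₀ t : ℝ} (hl : 2 * l₀ ≤ 6 * 8 ^ e + 2) (ht : |t| ≤ l₀) :
    |mgf id (Λ (insert e A)) t - mgf id (Λ A) t| ≤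
      2 * (l₀ ^ (6 * 8 ^ e + 1) / ((6 * 8 ^ e + 1).factorial : ℝ)) := by
  classical
  set n : ℕ := 6 * 8 ^ e + 2 with hn
  have hn1 : 1 ≤ n := by omega
  have hnsub : n - 1 = 6 * 8 ^ e + 1 := by omega
  have hln : 2 * l₀ ≤ n := by rw [hn]; push_cast; linarith
  set B : ℝ := l₀ ^ (n - 1) / ((n - 1).factorial : ℝ) with hB
  have hexp : Continuous fun x : ℝ => Real.exp (t * x) := Real.continuous_exp.comp (continuous_const.mul continuous_id)
  have hm : ∀ C : Finset ℕ, mgf id (Λ C) t = ∫ x, Real.exp (t * x) ∂(Λ C) := fun C => by simp only [mgf, id]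
  rw [hm, hm, integral_toggle_sub hΛ he hexp]
  -- the Riesz density and the Taylor split of the exponential
  set ρ : ℝ → ℝ := fun φ => ∏ k ∈ A, (1 + Real.cos ((8 : ℝ) ^ (k + 1) * φ)) with hρ
  have hρc : Continuous ρ := continuous_rieszDensity A
  set Tay : ℝ → ℝ := fun φ => ∑ j ∈ range (n - 1), (t * (c * Real.cos φ)) ^ j / (j.factorial : ℝ) with hTay
  set R : ℝ → ℝ := fun φ => Real.exp (t * (c * Real.cos φ)) - Tay φ with hR
  have hcosν : Continuous fun φ : ℝ => Real.cos ((8 : ℝ) ^ (e + 1) * φ) :=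
    Real.continuous_cos.comp (continuous_const.mul continuous_id)
  have hTayc : Continuous Tay := continuous_finsetSum _ fun j _ =>
    ((continuous_const.mul (continuous_const.mul Real.continuous_cos)).pow j).div_const _
  have hRc : Continuous R := (hexp.comp (continuous_const.mul Real.continuous_cos)).sub hTayc
  -- the Taylor part integrates to zero against `cos(8^{e+1}·)ρ_A`
  have hTay0 : ∫ φ in (0 : ℝ)..π, Tay φ * Real.cos ((8 : ℝ) ^ (e + 1) * φ) * ρ φ = 0 := by
    have e1 : (fun φ : ℝ => Tay φ * Real.cos ((8 : ℝ) ^ (e + 1) * φ) * ρ φ) = fun φ =>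
        ∑ j ∈ range (n - 1), (t * c) ^ j / (j.factorial : ℝ) *
          (Real.cos φ ^ j * Real.cos ((8 : ℝ) ^ (e + 1) * φ) * ρ φ) := by
      funext φ
      simp only [hTay, Finset.sum_mul]
      refine Finset.sum_congr rfl fun j _ => ?_
      rw [mul_pow, mul_pow]; ring
    have hint : ∀ j ∈ range (n - 1), IntervalIntegrable (fun φ : ℝ => (t * c) ^ j / (j.factorial : ℝ) *
        (Real.cos φ ^ j * Real.cos ((8 : ℝ) ^ (e + 1) * φ) * ρ φ)) volume 0 π := fun j _ => by
      have hcj : Continuous fun φ : ℝ => Real.cos φ ^ j * Real.cos ((8 : ℝ) ^ (e + 1) * φ) * ρ φ :=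
        ((Real.continuous_cos.pow j).mul hcosν).mul hρc
      exact (hcj.intervalIntegrable _ _).const_mul _
    rw [e1, intervalIntegral.integral_finsetSum hint]
    refine Finset.sum_eq_zero fun j hj => ?_
    rw [intervalIntegral.integral_const_mul, hρ,
      integral_cos_pow_mul_cosOct_mul_rieszDensity_eq_zero he (by have := Finset.mem_range.1 hj; omega), mul_zero]
  -- the remainder is bounded by `2B` pointwise
  have hRb : ∀ φ, |R φ * Real.cos ((8 : ℝ) ^ (e + 1) * φ)| ≤ 2 * B := fun φ => by
    rw [abs_mul]
    have hx : |c * Real.cos φ| ≤ 1 := by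
      rw [abs_mul]; exact mul_le_one₀ hc (abs_nonneg _) (Real.abs_cos_le_one _)
    have h1 : |R φ| ≤ 2 * B := abs_exp_sub_taylor_le hln hn1 ht hx
    have hB0 : 0 ≤ 2 * B := (abs_nonneg _).trans h1
    calc |R φ| * |Real.cos ((8 : ℝ) ^ (e + 1) * φ)| ≤ 2 * B * 1 :=
          mul_le_mul h1 (Real.abs_cos_le_one _) (abs_nonneg _) hB0
      _ = 2 * B := mul_one _
  have hsplit : (fun φ : ℝ => Real.exp (t * (c * Real.cos φ)) * Real.cos ((8 : ℝ) ^ (e + 1) * φ) * ρ φ) =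
      fun φ => Tay φ * Real.cos ((8 : ℝ) ^ (e + 1) * φ) * ρ φ +
        R φ * Real.cos ((8 : ℝ) ^ (e + 1) * φ) * ρ φ := by
    funext φ; simp only [hR]; ring
  have hi1 : IntervalIntegrable (fun φ : ℝ => Tay φ * Real.cos ((8 : ℝ) ^ (e + 1) * φ) * ρ φ) volume 0 π :=
    ((hTayc.mul hcosν).mul hρc).intervalIntegrable _ _
  have hi2 : IntervalIntegrable (fun φ : ℝ => R φ * Real.cos ((8 : ℝ) ^ (e + 1) * φ) * ρ φ) volume 0 π :=
    ((hRc.mul hcosν).mul hρc).intervalIntegrable _ _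
  show |1 / π * ∫ φ in (0 : ℝ)..π, Real.exp (t * (c * Real.cos φ)) * Real.cos ((8 : ℝ) ^ (e + 1) * φ) * ρ φ| ≤ 2 * B
  rw [hsplit, intervalIntegral.integral_add hi1 hi2, hTay0, zero_add]
  have hb := abs_integral_mul_rieszDensity_le (hRc.mul hcosν) hRb A
  rw [abs_mul, abs_div, abs_one, abs_of_pos Real.pi_pos]
  calc 1 / π * |∫ φ in (0 : ℝ)..π, R φ * Real.cos ((8 : ℝ) ^ (e + 1) * φ) * ρ φ| ≤ 1 / π * (2 * B * π) :=
        mul_le_mul_of_nonneg_left hb (by positivity)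
    _ = 2 * B := by field_simp

/-- ★ **THE WINDOW PRICE OF A TOGGLE (cgf).**  Same hypotheses, laws on `[−1,1]`:
`|cgf λ_{A∪{e}}(t) − cgf λ_A(t)| ≤ e^{l₀}·2·l₀^{6·8^e+1}∕(6·8^e+1)!` (both mgfs are `≥ e^{−l₀}`, module 64). [folklore] -/
theorem abs_cgf_toggle_sub_le {Λ : Finset ℕ → Measure ℝ} [hP : ∀ A, IsProbabilityMeasure (Λ A)]
    (hsupp : ∀ A, Λ A (Set.Icc (-1 : ℝ) 1)ᶜ = 0) {c : ℝ} (hc : |c| ≤ 1)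
    (hΛ : ∀ (A : Finset ℕ) (f : ℝ → ℝ), Continuous f →
      ∫ x, f x ∂(Λ A) = (1 / π) * ∫ φ in (0 : ℝ)..π, f (c * Real.cos φ) *
        ∏ e ∈ A, (1 + Real.cos ((8 : ℝ) ^ (e + 1) * φ)))
    {A : Finset ℕ} {e : ℕ} (he : e ∉ A) {l₀ t : ℝ} (hl : 2 * l₀ ≤ 6 * 8 ^ e + 2) (ht : |t| ≤ l₀) :
    |cgf id (Λ (insert e A)) t - cgf id (Λ A) t| ≤
      Real.exp l₀ * (2 * (l₀ ^ (6 * 8 ^ e + 1) / ((6 * 8 ^ e + 1).factorial : ℝ))) := by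
  have hlow : ∀ C, Real.exp (-l₀) ≤ mgf id (Λ C) t := fun C => exp_neg_le_mgf_id_of_Icc_symm (Λ C) (hsupp C) ht
  rw [cgf, cgf]
  exact (abs_log_sub_log_le_of_exp_neg_le (hlow _) (hlow _)).trans
    (mul_le_mul_of_nonneg_left (abs_mgf_toggle_sub_le hc hΛ he hl ht) (Real.exp_pos _).le)

/-! ## §3 The test of a level and its exact payment (scale `1`) [folklore] -/

/-- `(1 − z²)·T_n′(z) = n(T_{n−1}(z) − zT_n(z))` (Mathlib's `one_sub_X_sq_mul_derivative_T_eq_poly_in_T`, evaluated).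
[bookkeeping] -/
theorem one_sub_sq_mul_deriv_T (n : ℕ) (z : ℝ) :
    (1 - z ^ 2) * (derivative (T ℝ (n : ℤ))).eval z =
      n * ((T ℝ ((n : ℤ) - 1)).eval z - z * (T ℝ (n : ℤ)).eval z) := by
  have key := congrArg (Polynomial.eval z) (one_sub_X_sq_mul_derivative_T_eq_poly_in_T (R := ℝ) ((n : ℤ) - 1))
  simp only [sub_add_cancel, eval_mul, eval_sub, eval_one, eval_pow, eval_X, eval_add] at key
  have e1 : (((n : ℤ) - 1 : ℤ) : ℝ[X]).eval z = (n : ℝ) - 1 := by simp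
  rw [e1] at key
  linear_combination key

/-- ★ THE TEST OF A LEVEL: `g_n(x) = (1 − x²)T_n(x)∕(4n)` is `1`-Lipschitz and `1∕(4n)`-bounded on `[−1,1]`
(`n ≥ 1`; `|g_n′| ≤ (2 + 2n)∕(4n) ≤ 1` by `one_sub_sq_mul_deriv_T` and `|T_k| ≤ 1`). [folklore] -/
theorem rieszTest_lipschitz_bound {n : ℕ} (hn : 1 ≤ n) :
    (∀ x y : ℝ, x ∈ Set.Icc (-1 : ℝ) 1 → y ∈ Set.Icc (-1 : ℝ) 1 →
      |(1 - x ^ 2) * (T ℝ (n : ℤ)).eval x / (4 * (n : ℝ)) - (1 - y ^ 2) * (T ℝ (n : ℤ)).eval y / (4 * (n : ℝ))| ≤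
        1 * |x - y|) ∧
    ∀ x : ℝ, x ∈ Set.Icc (-1 : ℝ) 1 → |(1 - x ^ 2) * (T ℝ (n : ℤ)).eval x / (4 * (n : ℝ))| ≤ 1 / (4 * (n : ℝ)) := by
  have hnr : (1 : ℝ) ≤ n := by exact_mod_cast hn
  have hn0 : (0 : ℝ) < n := by linarith
  refine ⟨fun x y hx hy => ?_, fun x hx => ?_⟩
  · -- mean value inequality with `|g′| ≤ 1`
    have hderiv : ∀ z : ℝ, HasDerivAt (fun z => (1 - z ^ 2) * (T ℝ (n : ℤ)).eval z / (4 * (n : ℝ)))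
        ((-(2 * z) * (T ℝ (n : ℤ)).eval z + (1 - z ^ 2) * (derivative (T ℝ (n : ℤ))).eval z) / (4 * (n : ℝ))) z := by
      intro z
      have h1 : HasDerivAt (fun z : ℝ => 1 - z ^ 2) (-(2 * z)) z := by
        have := (hasDerivAt_pow 2 z).const_sub 1
        simpa [pow_one] using this
      have h2 := (T ℝ (n : ℤ)).hasDerivAt z
      exact (h1.mul h2).div_const _
    have hbound : ∀ z ∈ Set.Icc (-1 : ℝ) 1,
        ‖deriv (fun z => (1 - z ^ 2) * (T ℝ (n : ℤ)).eval z / (4 * (n : ℝ))) z‖ ≤ 1 := by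
      intro z hz
      rw [(hderiv z).deriv, Real.norm_eq_abs, one_sub_sq_mul_deriv_T]
      have hz1 : |z| ≤ 1 := abs_le.2 ⟨hz.1, hz.2⟩
      have hT : |(T ℝ (n : ℤ)).eval z| ≤ 1 := abs_eval_T_real_le_one _ hz1
      have hT' : |(T ℝ ((n : ℤ) - 1)).eval z| ≤ 1 := abs_eval_T_real_le_one _ hz1
      rw [abs_div, abs_of_pos (by positivity : (0 : ℝ) < 4 * n), div_le_one (by positivity)]
      have hzT : |z * (T ℝ (n : ℤ)).eval z| ≤ 1 := by
        rw [abs_mul]; exact mul_le_one₀ hz1 (abs_nonneg _) hT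
      calc |-(2 * z) * (T ℝ (n : ℤ)).eval z + n * ((T ℝ ((n : ℤ) - 1)).eval z - z * (T ℝ (n : ℤ)).eval z)|
          ≤ |-(2 * z) * (T ℝ (n : ℤ)).eval z| + |n * ((T ℝ ((n : ℤ) - 1)).eval z - z * (T ℝ (n : ℤ)).eval z)| :=
            abs_add_le _ _
        _ ≤ 2 * 1 + n * (1 + 1) := by
            refine add_le_add ?_ ?_
            · rw [abs_mul, abs_neg, abs_mul, abs_two]
              calc 2 * |z| * |(T ℝ (n : ℤ)).eval z| ≤ 2 * 1 * 1 := by gcongr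
                _ = 2 * 1 := by ring
            · rw [abs_mul, abs_of_pos hn0]
              exact mul_le_mul_of_nonneg_left ((abs_sub _ _).trans (add_le_add hT' hzT)) hn0.le
        _ ≤ 4 * n := by linarith
    have h := (convex_Icc (-1 : ℝ) 1).norm_image_sub_le_of_norm_deriv_le (fun z _ => (hderiv z).differentiableAt)
      hbound hy hx
    simpa only [Real.norm_eq_abs] using h
  · have hx1 : |x| ≤ 1 := abs_le.2 ⟨hx.1, hx.2⟩
    have hT : |(T ℝ (n : ℤ)).eval x| ≤ 1 := abs_eval_T_real_le_one _ hx1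
    have hsq : |1 - x ^ 2| ≤ 1 := by
      have h0 : 0 ≤ x ^ 2 := sq_nonneg x
      have h1 : x ^ 2 ≤ 1 := by nlinarith [hx.1, hx.2]
      rw [abs_le]; constructor <;> linarith
    rw [abs_div, abs_of_pos (by positivity : (0 : ℝ) < 4 * n), abs_mul]
    exact div_le_div_of_nonneg_right (mul_le_one₀ hsq (abs_nonneg _) hT) (by positivity)

/-- ★ **THE EXACT PAYMENT OF A TOGGLE (scale `1`).**  For `e ∉ A` and `n = 8^{e+1}`:
`∫g_n dλ_{A∪{e}} − ∫g_n dλ_A = 1∕(16n)` — at `x = cos φ` the test is `sin²φ·cos(nφ)∕(4n)`, and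
`∫_0^π sin²φ·cos²(nφ)·ρ_A = π∕4` (module 100 (d′)). [folklore] -/
theorem integral_rieszTest_toggle_sub {Λ : Finset ℕ → Measure ℝ}
    (hΛ : ∀ (A : Finset ℕ) (f : ℝ → ℝ), Continuous f →
      ∫ x, f x ∂(Λ A) = (1 / π) * ∫ φ in (0 : ℝ)..π, f (1 * Real.cos φ) *
        ∏ e ∈ A, (1 + Real.cos ((8 : ℝ) ^ (e + 1) * φ)))
    {A : Finset ℕ} {e : ℕ} (he : e ∉ A) :
    ∫ x, (1 - x ^ 2) * (T ℝ ((8 ^ (e + 1) : ℕ) : ℤ)).eval x / (4 * ((8 ^ (e + 1) : ℕ) : ℝ)) ∂(Λ (insert e A)) -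
      ∫ x, (1 - x ^ 2) * (T ℝ ((8 ^ (e + 1) : ℕ) : ℤ)).eval x / (4 * ((8 ^ (e + 1) : ℕ) : ℝ)) ∂(Λ A) =
        1 / (16 * ((8 ^ (e + 1) : ℕ) : ℝ)) := by
  have hcont : Continuous fun x : ℝ => (1 - x ^ 2) * (T ℝ ((8 ^ (e + 1) : ℕ) : ℤ)).eval x / (4 * ((8 ^ (e + 1) : ℕ) : ℝ)) :=
    ((continuous_const.sub (continuous_pow 2)).mul (Polynomial.continuous _)).div_const _
  rw [integral_toggle_sub hΛ he hcont]
  have hν : (((8 ^ (e + 1) : ℕ) : ℤ) : ℝ) = (8 : ℝ) ^ (e + 1) := by push_cast; ring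
  have hν' : ((8 ^ (e + 1) : ℕ) : ℝ) = (8 : ℝ) ^ (e + 1) := by push_cast; ring
  have e1 : (fun φ : ℝ => (1 - (1 * Real.cos φ) ^ 2) * (T ℝ ((8 ^ (e + 1) : ℕ) : ℤ)).eval (1 * Real.cos φ) /
      (4 * ((8 ^ (e + 1) : ℕ) : ℝ)) * Real.cos ((8 : ℝ) ^ (e + 1) * φ) *
        ∏ k ∈ A, (1 + Real.cos ((8 : ℝ) ^ (k + 1) * φ))) = fun φ => (1 / (4 * (8 : ℝ) ^ (e + 1))) *
      (Real.sin φ ^ 2 * Real.cos ((8 : ℝ) ^ (e + 1) * φ) ^ 2 * ∏ k ∈ A, (1 + Real.cos ((8 : ℝ) ^ (k + 1) * φ))) := by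
    funext φ
    rw [one_mul, T_real_cos, hν, hν', Real.sin_sq]
    ring
  rw [e1, intervalIntegral.integral_const_mul, integral_sin_sq_mul_cosOct_sq_mul_rieszDensity he, hν']
  field_simp
  ring

end Summit.QuantumFields.YangMills.Theorems.BalabanUVNodesN19RieszProductLaws

end
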